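import Summits.Ventures.GridStability.Bench.SMIBDeg4ARecertD2K13postD10Roa
import HarnessLib

/-!
# G1-cct SMIB — entry test of the kernel ROA piece in the REPLAY's coordinates `(d, ω)` (RQ-016 glue, L3a)

Venture GRIDFUSION; seat gridfusion-sos-3 (g3); lead 2026-08-27T06:09:28Z (RQ-016: certnum's kernel replay of the
post-fault leg of M′_SMIB = `SMIB.K13postD10` from the t_cl = 0.117 s end box must LAND in the certified piece
`S = {V ≤ 49/50}` of the «lsmax» claim 132a1037, kernel ROA `deg4_A_recertD2_K13postD10_K13postD10_roa`, p480553).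
Because `sin δˢ = s*` and `cos δˢ = c*` are EXACT rationals (model-1 `SMIB.sin_deltaK13` / `SMIB.cos_deltaK13`,
`(c*, s*) = (2051032, 2899575)/3551657`), the recast point of a post-fault state `(d, ω)` is AFFINE in
`(sin d, cos d)`: `sin(d − δˢ) = c*·sin d − s*·cos d`, `1 − cos(d − δˢ) = 1 − c*·cos d − s*·sin d`. So the entry
condition is the polynomial inequality `G(sin d, cos d, ω) ≤ 49/50` that an interval evaluation on a replay stage
box decides (exact expansion: HOME cert/sos-3/cct/smib/K13postD10-lsmax-recast-inequality.json a15c2f1d65c018de) —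
no box `W` and no new SOS certificate are needed on the gridfusion side.

* `recastEntry_sigma` / `recastEntry_kappa` — the two affine identities;
* `K13postD10_roa_of_state` — the kernel ROA restated with the hypothesis on an arbitrary initial STATE `(d₀, ω₀)`
  in the `(sin d₀, cos d₀, ω₀)` form: every post-fault solution `x` with `x 0 = (d₀, ω₀)`,
  `V(c* sin d₀ − s* cos d₀, 1 − c* cos d₀ − s* sin d₀, ω₀) ≤ 49/50` and `|d₀ − δˢ| < π` keeps `V ≤ 49/50`, never
  slips a pole and tends to `(δˢ, 0)`.

THREE COLUMNS: pure kernel glue (MODELLED M′_SMIB as in the Roa file); nothing VALIDATED; no sentence about a grid.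
-/

namespace Summit.Ventures.GridStability.Bench.SMIB

open Set Filter Topology Real
open Summit.Ventures.GridStability.Models

/-- `sin(d − δˢ) = c*·sin d − s*·cos d` with the exact rational circle point of the instance. [folklore] -/
theorem recastEntry_sigma (d : ℝ) :
    Real.sin (d - SMIB.deltaK13) = (SMIB.cStar : ℝ) * Real.sin d - (SMIB.sStar : ℝ) * Real.cos d := by
  rw [Real.sin_sub, SMIB.sin_deltaK13, SMIB.cos_deltaK13]; ring

/-- `1 − cos(d − δˢ) = 1 − c*·cos d − s*·sin d`. [folklore] -/
theorem recastEntry_kappa (d : ℝ) :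
    1 - Real.cos (d - SMIB.deltaK13) = 1 - (SMIB.cStar : ℝ) * Real.cos d - (SMIB.sStar : ℝ) * Real.sin d := by
  rw [Real.cos_sub, SMIB.sin_deltaK13, SMIB.cos_deltaK13]; ring

/-- **Kernel ROA of the «lsmax» piece, entry stated on a post-fault STATE in the replay's coordinates** (RQ-016 L3a):
for every solution `x` of `SMIB.K13postD10` on `[0, ∞)` issued from `(d₀, ω₀)` with
`V(c*·sin d₀ − s*·cos d₀, 1 − c*·cos d₀ − s*·sin d₀, ω₀) ≤ 49/50` and `|d₀ − δˢ| < π`: `V ≤ 49/50` along the recast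
state and `|d − δˢ| < π` for all `t ≥ 0`, and `x → (δˢ, 0)`. CERTIFIED: `deg4_A_recertD2_K13postD10_K13postD10_roa`
(p480553) + the two affine identities. MODELLED: M′ = SMIB-K13post-D10. [folklore] -/
theorem K13postD10_roa_of_state {d₀ ω₀ : ℝ} {x : ℝ → ℝ × ℝ} (hx : SMIB.K13postD10.IsSolutionOn x (Ici 0))
    (hx0 : x 0 = (d₀, ω₀))
    (hG : deg4_A_recertD2_K13postD10_V ((SMIB.cStar : ℝ) * Real.sin d₀ - (SMIB.sStar : ℝ) * Real.cos d₀)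
      (1 - (SMIB.cStar : ℝ) * Real.cos d₀ - (SMIB.sStar : ℝ) * Real.sin d₀) ω₀ ≤ (49 : ℝ) / 50)
    (hwin : |d₀ - SMIB.deltaK13| < π) :
    (∀ t, 0 ≤ t → deg4_A_recertD2_K13postD10_V (Real.sin ((x t).1 - SMIB.deltaK13))
        (1 - Real.cos ((x t).1 - SMIB.deltaK13)) (x t).2 ≤ (49 : ℝ) / 50 ∧ |(x t).1 - SMIB.deltaK13| < π) ∧
      Tendsto x atTop (𝓝 (SMIB.deltaK13, 0)) := by
  have hγ : (49 : ℝ) / 50 ≤ deg4_A_recertD2_K13postD10_level := by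
    simp only [deg4_A_recertD2_K13postD10_level]; norm_num
  have h0V : deg4_A_recertD2_K13postD10_V (Real.sin ((x 0).1 - SMIB.deltaK13))
      (1 - Real.cos ((x 0).1 - SMIB.deltaK13)) (x 0).2 ≤ (49 : ℝ) / 50 := by
    rw [hx0, recastEntry_sigma, recastEntry_kappa]; exact hG
  have h0win : |(x 0).1 - SMIB.deltaK13| < π := by rw [hx0]; exact hwin
  exact deg4_A_recertD2_K13postD10_K13postD10_roa (by norm_num) hγ hx h0V h0win

end Summit.Ventures.GridStability.Bench.SMIB
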